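import Mathlib
import Literature.MathematicalPhysics.QuantumFieldTheory.Balaban1983to89.T3YM3TorusStatement
import Literature.MathematicalPhysics.QuantumFieldTheory.Balaban1983to89.T3NestedUnitLaws
import Literature.MathematicalPhysics.QuantumFieldTheory.Balaban1983to89.T3UnitLawDensityEML
import Literature.MathematicalPhysics.QuantumFieldTheory.Balaban1983to89.BalabanUVClass
import Literature.MathematicalPhysics.QuantumFieldTheory.Balaban1983to89.T3UnitScaleTilt
import Literature.MathematicalPhysics.QuantumFieldTheory.Balaban1983to89.B12RegularClassInvariance263
import Literature.MathematicalPhysics.QuantumFieldTheory.Balaban1983to89.T4ExpWindowSmallField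
import Summits.QuantumFields.YangMills.Theorems.BackwardLiouvilleRigidityFlatRatioTerminationOneBondChains
import Summits.QuantumFields.YangMills.Theorems.BackwardLiouvilleRigidityFlatRatioTerminationGaugeMovesSU2
import Summits.QuantumFields.YangMills.Theorems.BackwardLiouvilleRigidityFlatRatioTerminationChordContraction

/-!
# Route `BackwardLiouvilleRigidity`, support `FlatRatioTermination` (stmt-QuantumFields-22542) — registered stub `stub_gaugeSmallChains`

Planner ym-r3-idea-1 g10's re-cut skeleton (`Cruxes/FluctuationComparisonRegPrIntL/Lines/flat_ratio_termination.lean`, sha 6f6fdb21):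
`stub_innerWindowGaugeSmall` (the global gauge, XL) → `stub_gaugeSmallChains` (THIS FILE) → `stub_thresholds` → `stub_windowTV` (landed) →
`stub_pushToZero` (landed).  STATEMENT (verbatim): a configuration `U` in `PlaqSmall δ` that is bondwise `η`-small in SOME gauge
(`dist1 (U^u b) < η` for all bonds, `0 < η ≤ 1/4`) is joined to the trivial configuration by `≤ #PBond²` one-bond moves inside `PlaqSmall θ`
whenever `δ + 32η² < θ` and `1/η² + 2/η + 4 ≤ #PBond`.

PROOF.  `1 = C₀ → C₁ → ⋯ → C_M = U^u → U` with `M = ⌈1/η⌉`, `C_k e = quatToSU2 (1 + (k/M)(su2Quat (U^u e) − 1))` the CHORD CONTRACTION in the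
quaternion model: every `C_k` lies in `PlaqSmall (δ + 16η²)` (`…ChordContraction.dist1_plaqHol_chord_le`: majorant for the degree-≥2 terms of the
four-fold product, normalisation loss ≤ η²), consecutive ones are bondwise within `η/M + η²/2 ≤ 3η²/2` (`dist1_chordStep_le`), so each sweep is a
chain of `#PBond` one-bond moves inside `PlaqSmall (δ + 22η²) ⊆ PlaqSmall θ` (`…OneBondChains.chain_of_bondwise`); the last leg is the gauge chain
of `u⁻¹` (`…GaugeMovesSU2.chain_gaugeAct_su2`, `≤ #PBond·(⌈8π/(θ−δ)⌉ + 1) ≤ #PBond·(1/η² + 2)` moves, `π ≤ 4`); in total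
`≤ #PBond·(1/η + 1 + 1/η² + 2) ≤ #PBond·(1/η² + 2/η + 4) ≤ #PBond²`.

HONEST SCOPE.  One registered stub of a SUPPORT item; the hardest stub `stub_innerWindowGaugeSmall` (a volume-uniform global gauge for inner-window
configurations), the crux `ClassLimitTrajectories`, rung R3 (RECORD rung) and every summit statement stay open; nothing here bears on the Yang–Mills
mass gap.
-/

namespace Summit.QuantumFields.YangMills.Theorems.FlatRatioTermination

/-! ## §B The registered stub `stub_gaugeSmallChains` -/

section Stub

open Quaternion
open Literature.MathematicalPhysics.QuantumLattice
open Literature.MathematicalPhysics.QuantumFieldTheory.Balaban1983to89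
open scoped Matrix.Norms.L2Operator

/-- **REGISTERED STUB `stub_gaugeSmallChains`** of the skeleton for `FlatRatioTermination` (stmt-QuantumFields-22542, planner ym-r3-idea-1 g10 re-cut,
sha 6f6fdb21), verbatim: a configuration in `PlaqSmall δ` which is bondwise `η`-small in SOME gauge is joined to the trivial configuration by
`≤ #PBond²` one-bond moves inside `PlaqSmall θ`, `θ > δ + 32η²`, `#PBond ≥ 1/η² + 2/η + 4`.  Chain: `1 = C₀ → C₁ → ⋯ → C_M = U^u`, `M = ⌈1/η⌉`, along
the chord contraction (every `C_k` in `PlaqSmall (δ + 16η²)`, consecutive ones bondwise within `3η²/2`, so every hybrid in `PlaqSmall (δ + 22η²)`),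
then `U^u → U` by the gauge chain of `u⁻¹` (`≤ #PBond·(⌈8π/(θ−δ)⌉ + 1) ≤ #PBond·(1/η² + 2)` moves, `π ≤ 4`). [folklore] -/
theorem stub_gaugeSmallChains : open MeasureTheory Filter Topology Literature.MathematicalPhysics.QuantumFieldTheory.Balaban1983to89 T3ContinuumYM3Torus T3NestedUnitLaws T3UnitLawDensityEML T4Continuum BalabanUVClass T3UnitScaleTilt in ∀ (F : T3Family) (j : ℕ) (θ δ η : ℝ), 0 < η → η ≤ 1 / 4 → 0 ≤ δ → δ + 32 * η ^ 2 < θ → 1 / η ^ 2 + 2 / η + 4 ≤ (Fintype.card (PBond (F.P j) 0) : ℝ) → ∀ U : GaugeField (F.P j) 0 ↥(Matrix.specialUnitaryGroup (Fin 2) ℂ), PlaqSmall δ U → (∃ u : GaugeTransf (F.P j) 0 ↥(Matrix.specialUnitaryGroup (Fin 2) ℂ), ∀ b : PBond (F.P j) 0, dist1 (GaugeField.gaugeAct u U b) < η) → ∃ (n : ℕ) (W : ℕ → GaugeField (F.P j) 0 ↥(Matrix.specialUnitaryGroup (Fin 2) ℂ)), n ≤ Fintype.card (PBond (F.P j) 0)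 ^ 2 ∧ (∀ e, W 0 e = 1) ∧ W n = U ∧ (∀ i, i ≤ n → PlaqSmall (θ) (W i)) ∧ (∀ i, i < n → ∃ b : PBond (F.P j) 0, ∀ e, e ≠ b → W i e = W (i + 1) e) := by
  intro F j θ δ η hη0 hη4 hδ0 hθ hcard U hU hgauge
  obtain ⟨u, hu⟩ := hgauge
  set A : GaugeField (F.P j) 0 ↥(Matrix.specialUnitaryGroup (Fin 2) ℂ) := GaugeField.gaugeAct u U with hAdef
  have hA : PlaqSmall δ A := (B12RegularClassInvariance263.plaqSmall_gaugeAct_iff δ u U).mpr hU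
  -- the bond quaternions
  set a : PBond (F.P j) 0 → ℍ := fun e => su2Quat (A e) - 1 with hadef
  have ha : ∀ e, ‖a e‖ ≤ η := fun e => by rw [hadef]; dsimp only; rw [← T4ExpWindowSmallField.dist1_eq_norm_su2Quat_sub_one]; exact (hu e).le
  have ha1 : ∀ e, ‖1 + a e‖ = 1 := fun e => by rw [hadef]; dsimp only; rw [add_sub_cancel]; exact norm_su2Quat _
  -- the number of sweeps
  set M : ℕ := ⌈1 / η⌉₊ with hMdef
  have hMge : 1 / η ≤ (M : ℝ) := Nat.le_ceil _
  have h4η : 4 ≤ 1 / η := by rw [le_div_iff₀ hη0]; linarith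
  have hMpos : (0 : ℝ) < M := lt_of_lt_of_le (by linarith) hMge
  have hM0 : M ≠ 0 := by intro h; rw [h] at hMpos; simp at hMpos
  have hΔ : 1 / (M : ℝ) ≤ η := by
    rw [div_le_iff₀ hMpos]
    have := mul_le_mul_of_nonneg_left hMge hη0.le
    rw [mul_one_div_cancel hη0.ne'] at this
    linarith
  -- the chord configurations
  set C : ℕ → GaugeField (F.P j) 0 ↥(Matrix.specialUnitaryGroup (Fin 2) ℂ) := fun k e => quatToSU2 (1 + ((k : ℝ) / M) • a e) with hCdef
  have h11 : quatToSU2 (1 : ℍ) = 1 :=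
    Subtype.ext (by rw [coe_quatToSU2_of_norm_eq_one norm_one, quatMatrix_one]; rfl)
  have hC0 : C 0 = 1 := by
    funext e; simp only [hCdef, Nat.cast_zero, zero_div, zero_smul, add_zero, h11]; rfl
  have hCM : C M = A := by
    funext e; simp only [hCdef, div_self (ne_of_gt hMpos), one_smul, hadef, add_sub_cancel, quatToSU2_su2Quat]
  have htk : ∀ k : ℕ, k ≤ M → (0 : ℝ) ≤ k / M ∧ (k : ℝ) / M ≤ 1 := fun k hk =>
    ⟨by positivity, by rw [div_le_one hMpos]; exact_mod_cast hk⟩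
  -- every chord configuration is in `PlaqSmall (δ + 16η²)`
  have hCsmall : ∀ k, k ≤ M → PlaqSmall (δ + 16 * η ^ 2) (C k) := by
    intro k hk p
    have h := dist1_plaqHol_chord_le A hη4 ha (htk k hk).1 (htk k hk).2 p
    exact lt_of_le_of_lt h (by linarith [hA p])
  -- consecutive chord configurations are bondwise within `3η²/2`
  have hCstep : ∀ k, k < M → ∀ e, GaugeGroup.dist1 (C (k + 1) e * (C k e)⁻¹) ≤ 3 * η ^ 2 / 2 := by
    intro k hk e
    have h := dist1_chordStep_le (ha1 e) hη4 (ha e) (htk k hk.le).1 (htk k hk.le).2 (htk (k + 1) hk).1 (htk (k + 1) hk).2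
    have hdt : |((k + 1 : ℕ) : ℝ) / M - (k : ℝ) / M| = 1 / M := by
      rw [Nat.cast_succ, ← sub_div, add_sub_cancel_left, abs_of_nonneg (by positivity)]
    rw [hdt] at h
    calc GaugeGroup.dist1 (C (k + 1) e * (C k e)⁻¹) ≤ 1 / M * η + η ^ 2 / 2 := h
      _ ≤ η * η + η ^ 2 / 2 := by nlinarith [hΔ]
      _ = 3 * η ^ 2 / 2 := by ring
  -- chains `C 0 → C k`
  have hchain : ∀ k, k ≤ M → ∃ (n : ℕ) (W : ℕ → GaugeField (F.P j) 0 ↥(Matrix.specialUnitaryGroup (Fin 2) ℂ)),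
      n ≤ Fintype.card (PBond (F.P j) 0) * k ∧ W 0 = C 0 ∧ W n = C k ∧ (∀ i, i ≤ n → PlaqSmall θ (W i)) ∧
      (∀ i, i < n → ∃ b : PBond (F.P j) 0, ∀ e, e ≠ b → W i e = W (i + 1) e) := by
    intro k
    induction k with
    | zero =>
      intro _
      refine ⟨0, fun _ => C 0, le_rfl, rfl, rfl, fun i _ p => lt_trans (hCsmall 0 (Nat.zero_le _) p) (by nlinarith), ?_⟩
      intro i hi; exact (Nat.not_lt_zero i hi).elim
    | succ k ih =>
      intro hk
      obtain h1 := ih (Nat.le_of_succ_le hk)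
      have h2 := chain_of_bondwise (δ + 16 * η ^ 2) θ (s := 3 * η ^ 2 / 2) (by positivity)
        (by nlinarith [sq_nonneg η]) (C k)
        (hCsmall k (Nat.le_of_succ_le hk)) (fun e => C (k + 1) e * (C k e)⁻¹) (hCstep k hk)
      have heq : (fun e => C (k + 1) e * (C k e)⁻¹ * C k e) = C (k + 1) := funext fun e => inv_mul_cancel_right _ _
      rw [heq] at h2
      have h := chain_trans h1 h2
      simpa only [Nat.mul_succ] using h
  obtain hCA := hchain M le_rfl
  rw [hC0, hCM] at hCA
  -- the gauge chain `A → U`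
  have hδθ : δ < θ := by nlinarith
  have hUeq : GaugeField.gaugeAct (fun x => (u x)⁻¹) A = U := by
    rw [hAdef, ← gaugeAct_mul']; funext b; simp [GaugeField.gaugeAct]
  have hAU := chain_gaugeAct_su2 δ θ hδθ A hA (fun x => (u x)⁻¹)
  rw [hUeq] at hAU
  obtain ⟨n, W, hn, hW0, hWn, hS, hst⟩ := chain_trans hCA hAU
  refine ⟨n, W, ?_, fun e => by rw [hW0]; rfl, hWn, hS, hst⟩
  -- the count
  set K : ℕ := ⌈8 * Real.pi / (θ - δ)⌉₊ + 1 with hKdef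
  have hK : (K : ℝ) ≤ 1 / η ^ 2 + 2 := by
    have h1 : (⌈8 * Real.pi / (θ - δ)⌉₊ : ℝ) < 8 * Real.pi / (θ - δ) + 1 := Nat.ceil_lt_add_one (by positivity)
    have h2 : 8 * Real.pi / (θ - δ) ≤ 8 * Real.pi / (32 * η ^ 2) :=
      div_le_div_of_nonneg_left (by positivity) (by positivity) (by linarith)
    have h3 : 8 * Real.pi / (32 * η ^ 2) ≤ 1 / η ^ 2 := by
      rw [div_le_div_iff₀ (by positivity) (by positivity)]; nlinarith [Real.pi_le_four, sq_nonneg η]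
    rw [hKdef]; push_cast; linarith
  have hM : (M : ℝ) ≤ 1 / η + 1 := by
    have := Nat.ceil_lt_add_one (show (0 : ℝ) ≤ 1 / η by positivity)
    rw [hMdef]; linarith
  have hMK : ((M + K : ℕ) : ℝ) ≤ Fintype.card (PBond (F.P j) 0) := by
    rw [Nat.cast_add]
    have h0 : 0 ≤ 1 / η := by positivity
    have hsum : (M : ℝ) + K ≤ 1 / η ^ 2 + 2 / η + 4 := by
      have h2 : 2 / η = 2 * (1 / η) := by ring
      rw [h2]; linarith
    exact hsum.trans hcard
  have hMK' : M + K ≤ Fintype.card (PBond (F.P j) 0) := by exact_mod_cast hMK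
  calc n ≤ Fintype.card (PBond (F.P j) 0) * M + Fintype.card (PBond (F.P j) 0) * K := hn
    _ = Fintype.card (PBond (F.P j) 0) * (M + K) := by ring
    _ ≤ Fintype.card (PBond (F.P j) 0) * Fintype.card (PBond (F.P j) 0) := Nat.mul_le_mul_left _ hMK'
    _ = Fintype.card (PBond (F.P j) 0) ^ 2 := (sq _).symm

end Stub

end Summit.QuantumFields.YangMills.Theorems.FlatRatioTermination
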